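import Summits.QuantumFields.YangMills.Theorems.ComplexCouplingChannelComplexStrongCouplingAnchor
import Summits.QuantumFields.YangMills.Theorems.ComplexCouplingChannelFreeEnergyWindowChannelStubLocalRePart
import Summits.QuantumFields.YangMills.Theorems.ComplexCouplingChannelFreeEnergyWindowChannelStubReChain
import Summits.QuantumFields.YangMills.Theorems.FreeEnergyWindowChannel.Negative.WitnessRigidity
import Literature.MathematicalPhysics.QuantumFieldTheory.WilsonFinTorusPartitionComplex
import HarnessLib

/-!
# The symmetric-torus remainder is a transport invariant: `FreeEnergyWindowChannel` forces it to vanish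
# at every large real coupling, for every admissible gauge group

Crux `FreeEnergyWindowChannel` (stmt-QuantumFields-18842, route `ComplexCouplingChannel` of `QuantumFields/YangMills`),
line `Sketch` (idea `log-envelope-transport`, crux-ideate k2), NEGATION HALF (the k2 sketch's
`torusRemainder_tendsto_zero_of_channel` / `not_freeEnergyWindowChannel_of_torusRemainder`), lead c2.

The crux asks, for EVERY compact simple `G` (tree sense: connected, non-abelian, closed connected normal subgroups
trivial, a faithful unitary representation exists — centre-free quotients such as `SO(3)` are admitted, tree
`isCompactSimpleLieGroup_SO3`) and every faithful unitary `r`, beyond some `β₁`, for every `β ≥ β₁` and `ρ > 0`, for an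
open connected `D ∋ β` through a real `x`, `|x| < ρ`, one holomorphic `f` on `D` and a constant `M` with
`Z_P z ≠ 0 ∧ |log ‖Z_P z‖ + P⁴ Re f z| ≤ M` for all large `P`, where `Z_P z = wilsonFinTorusPartitionC r.ρ z P P P P` is the
complex-coupling Wilson partition function of the symmetric torus `P⁴`.

THIS FILE PROVES (sorry-free):

* `remainder_tendsto_zero_of_window_of_pinning` — abstract one-variable engine: a window `|log ‖Z_P‖ + P⁴ Re f| ≤ M` on an
  open preconnected `D`, PINNED to `ε_P → 0` on a neighbourhood of one point of `D`, tends to `0` at EVERY point of `D`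
  (the landed real-part two-constants chain `stub_reChain`: `|u| ≤ C₀ ε^θ B^{1-θ}`).
* `torusRemainder_tendsto_zero_of_freeEnergyWindowChannel` — **the torus remainder is a transport invariant**: the crux
  and the PROVED strong-coupling anchor (`complexStrongCouplingAnchor_proof`: `|log ‖Z_P‖ + P⁴ Re f_A| ≤ C P⁴ e^{-cP}` on
  `‖z‖ < ρ₀`) force, for every admissible `(G, r)` and every `β ≥ β₁`, a real constant `F` (namely `Re f β`) with
  `log Z_P(β) + P⁴ F → 0` as `P → ∞`: on the overlap `D ∩ {‖z‖ < ρ₀}` the two windows pin `Re f = Re f_A`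
  (Archimedean step `nonpos_of_forall_pow_four_mul_le`), so the remainder is `O(P⁴ e^{-cP})` there, and the chain carries the
  smallness to `β`.  In words: the constant term `κ(β)` of `log Z_P(β) = -P⁴ f(β) + κ(β) + o(1)` is `0` on the anchor disc
  (cluster expansion) and CANNOT CHANGE along any zero-free window channel — whatever complex detour the channel takes.
* `doublingRemainder_tendsto_zero_of_freeEnergyWindowChannel` — the `F`-free form: `log Z_{2P}(β) − 16 log Z_P(β) → 0`.
* `not_freeEnergyWindowChannel_of_torusRemainder` — hence, for any admissible `(G, r)`: if at arbitrarily large real `β`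
  the remainder `log Z_P(β) + P⁴ F` fails to tend to `0` for EVERY real `F`, the crux is false;
  `not_freeEnergyWindowChannel_of_doublingRemainder` — the same from the doubling form;
  `stub_torusRemainderRigidity` — the registered stub name of line `Sketch` (layer 3) for the rigidity theorem.
* The companion file `FreeEnergyWindowChannelFalseOfSo3TorusRemainderNonvanishing.lean` states the physics hypothesis
  H = `So3TorusRemainderNonvanishing` (one lattice gauge theory, real coupling) and derives `H → ¬ FreeEnergyWindowChannel`.

WHY H IS THE EXPECTED PHYSICS (not provable here — confinement grade).  `SO(3) = SU(2)/ℤ₂` is admissible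
(`isCompactSimpleLieGroup_SO3`, `nonempty_latticeRep_SO3`, Borel σ-algebra).  Its Wilson lattice gauge theory is the
`SU(2)` theory with an adjoint-type (centre-blind) action; at weak coupling, where `ℤ₂` monopoles are suppressed, it is the
`SU(2)` theory summed over all 't Hooft twist sectors `H²(T⁴; ℤ₂)` (de Forcrand–Jahn, Nucl. Phys. B 651 (2003) 125,
hep-lat/0211004; hep-lat/0205026 §5), and in the confined regime `P → ∞` every twist sector becomes degenerate with the
untwisted one (magnetic-flux free energy `→ 0`: 't Hooft, Nucl. Phys. B 153 (1979) 141; Kovács–Tomboulis, Phys. Rev.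
Lett. 85 (2000) 704; de Forcrand–von Smekal, Phys. Rev. D 66 (2002) 011504), so `log Z_P(β) = -P⁴ f(β) + κ + o(1)` with
`κ = log (|H²|·|H⁰|/|H¹|) = log 8 ≠ 0` (the `T⁴` partition function of the infrared `ℤ₂` 2-form gauge theory,
Gaiotto–Kapustin–Seiberg–Willett, JHEP 02 (2015) 172, arXiv:1412.5148); at strong coupling `κ = 0` is a THEOREM (the
anchor).  By the invariant no window channel — real or complex — joins the two: the crux as typed (`∀` compact simple `G`)
fails at `(SO(3), r)`.  For simply connected `G` (`SU(N)`, unique confined vacuum, no flux sectors) `κ = 0` is expected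
and the invariant raises no obstruction; the natural repair of the crux is the hypothesis `[SimplyConnectedSpace G]`
(planners' call).  Note that the route's own `HarmonicMeasureEngine` needs `κ = 0` downstream (thermal trace `→ 0`).

References: R. Nevanlinna, *Eindeutige analytische Funktionen* (1936) §III.2 (two-constants theorem); route file
`Summits/QuantumFields/YangMills/Theses/ComplexCouplingChannel.lean`; crux idea cards
`Summits/QuantumFields/YangMills/Cruxes/FreeEnergyWindowChannel/Ideas/{log-envelope-transport,flux-sector-torus-constant}.md`.
-/

set_option autoImplicit false

noncomputable section

open scoped Topology
open MeasureTheory Filter Set Metric Complex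
open Literature.MathematicalPhysics.QuantumFieldTheory

namespace Summit.QuantumFields.YangMills.Theorems.FreeEnergyWindowChannel.Negative

/-! ## §1 The abstract engine: a pinned window remainder tends to zero everywhere -/

/-- **Pinned windows decay everywhere** (one complex variable).  Let `Z_P` be entire, `f` holomorphic on an open
preconnected `D`, and suppose the window `Z_P z ≠ 0 ∧ |log ‖Z_P z‖ + P⁴ Re f z| ≤ M` holds on `D` for `P ≥ P₀`, while
on the part of `D` within distance `r₀` of a point `x ∈ D` the same quantity is `≤ ε_P` with `0 < ε_P → 0`.  Then
`log ‖Z_P z‖ + P⁴ Re f z → 0` at EVERY `z ∈ D`.  Proof: `u_P = log ‖Z_P‖ + P⁴ Re f` is locally the real part of a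
holomorphic function (local holomorphic logarithm, `exists_differentiableOn_re_eq_log_norm`), so the landed real-part
two-constants chain `stub_reChain` on the compact `{z}` gives `|u_P z| ≤ C₀ ε_P^θ B^{1-θ}` with `B = max M 1`,
`θ > 0`. [folklore] -/
theorem remainder_tendsto_zero_of_window_of_pinning
    (Z : ℕ → ℂ → ℂ) (D : Set ℂ) (hDo : IsOpen D) (hDc : IsPreconnected D)
    (hZ : ∀ P : ℕ, Differentiable ℂ (Z P)) (x : ℂ) (hx : x ∈ D) (r₀ : ℝ) (hr₀ : 0 < r₀)
    (f : ℂ → ℂ) (hf : DifferentiableOn ℂ f D) (M : ℝ) (P₀ : ℕ)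
    (hwin : ∀ P : ℕ, P₀ ≤ P → ∀ z ∈ D, Z P z ≠ 0 ∧ |Real.log ‖Z P z‖ + (P : ℝ) ^ 4 * (f z).re| ≤ M)
    (ε : ℕ → ℝ) (hε : ∀ P : ℕ, 0 < ε P) (hεt : Tendsto ε atTop (𝓝 0))
    (hpin : ∀ P : ℕ, P₀ ≤ P → ∀ z ∈ D, dist z x < r₀ →
      |Real.log ‖Z P z‖ + (P : ℝ) ^ 4 * (f z).re| ≤ ε P) :
    ∀ z ∈ D, Tendsto (fun P : ℕ => Real.log ‖Z P z‖ + (P : ℝ) ^ 4 * (f z).re) atTop (𝓝 0) := by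
  intro z hz
  obtain ⟨θ, hθ0, -, C₀, hC₀, hchain⟩ :=
    stub_reChain D hDo hDc x hx r₀ hr₀ {z} isCompact_singleton (singleton_subset_iff.2 hz)
  set B : ℝ := max M 1 with hB
  have hB0 : 0 < B := lt_of_lt_of_le one_pos (le_max_right _ _)
  -- the bound at `z` for every `P ≥ P₀` with `ε P ≤ 1`
  have hbound : ∀ P : ℕ, P₀ ≤ P → ε P ≤ 1 →
      |Real.log ‖Z P z‖ + (P : ℝ) ^ 4 * (f z).re| ≤ C₀ * ε P ^ θ * B ^ (1 - θ) := by
    intro P hP hε1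
    set u : ℂ → ℝ := fun w => Real.log ‖Z P w‖ + (P : ℝ) ^ 4 * (f w).re with hu
    -- `u` is locally the real part of a holomorphic function on `D`
    have hure : ∀ (c : ℂ) (R : ℝ), 0 < R → ball c R ⊆ D →
        ∃ φ : ℂ → ℂ, DifferentiableOn ℂ φ (ball c R) ∧ ∀ w ∈ ball c R, (φ w).re = u w := by
      intro c R hR hsub
      obtain ⟨g, hgd, hg⟩ := exists_differentiableOn_re_eq_log_norm hR ((hZ P).differentiableOn)
        fun w hw => (hwin P hP w (hsub hw)).1
      refine ⟨fun w => g w + (P : ℂ) ^ 4 * f w, hgd.add ((differentiableOn_const _).mul (hf.mono hsub)), ?_⟩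
      intro w hw
      have hre : ((P : ℂ) ^ 4 * f w).re = (P : ℝ) ^ 4 * (f w).re := by
        rw [show ((P : ℂ) ^ 4) = (((P : ℝ) ^ 4 : ℝ) : ℂ) from by push_cast; ring, Complex.re_ofReal_mul]
      simp only [hu, Complex.add_re, hg w hw, hre]
    have hbig : ∀ w ∈ D, |u w| ≤ B := fun w hw => ((hwin P hP w hw).2).trans (le_max_left _ _)
    have hsmall : ∀ w ∈ D, dist w x < r₀ → |u w| ≤ ε P := fun w hw hwx => hpin P hP w hw hwx
    have hεB : ε P ≤ B := hε1.trans (le_max_right _ _)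
    exact hchain u B (ε P) hure (hε P) hεB hbig hsmall z (mem_singleton z)
  -- eventually `ε P ≤ 1` and `P ≥ P₀`
  have hev : ∀ᶠ P : ℕ in atTop, |Real.log ‖Z P z‖ + (P : ℝ) ^ 4 * (f z).re| ≤ C₀ * ε P ^ θ * B ^ (1 - θ) := by
    have h1 : ∀ᶠ P : ℕ in atTop, ε P < 1 := hεt.eventually (gt_mem_nhds one_pos)
    have h2 : ∀ᶠ P : ℕ in atTop, P₀ ≤ P := eventually_ge_atTop P₀
    filter_upwards [h1, h2] with P hP1 hP2 using hbound P hP2 hP1.le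
  -- the right-hand side tends to `0`
  have hrhs : Tendsto (fun P : ℕ => C₀ * ε P ^ θ * B ^ (1 - θ)) atTop (𝓝 0) := by
    have h1 : Tendsto (fun P : ℕ => ε P ^ θ) atTop (𝓝 0) := by
      have := hεt.rpow_const (p := θ) (Or.inr hθ0.le)
      simpa [Real.zero_rpow hθ0.ne'] using this
    have h2 := (h1.const_mul C₀).mul_const (B ^ (1 - θ))
    simpa using h2
  refine squeeze_zero_norm' ?_ hrhs
  filter_upwards [hev] with P hP
  rwa [Real.norm_eq_abs]

/-! ## §2 The crux forces the torus remainder to vanish at every large real coupling -/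

/-- **The torus remainder is a transport invariant.**  `FreeEnergyWindowChannel` (with the PROVED strong-coupling
anchor) forces, for every admissible `(G, r)`, beyond some `β₁`, at every real `β ≥ β₁`, a real constant `F` with
`log Z(β; P⁴) + P⁴ F → 0` as `P → ∞` (`Z(β; P⁴) = wilsonFinTorusPartition r.ρ β P P P P > 0` the physical symmetric-torus
partition function): the crux's window at `(β, ρ₀/2)` and the anchor's window on `‖z‖ < ρ₀` overlap near the real
point `x`, where the Archimedean step pins `Re f = Re f_A`, so the crux's remainder is `≤ C P⁴ e^{-cP} ≤ A e^{-cP/2}`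
there, and `remainder_tendsto_zero_of_window_of_pinning` carries the decay to `β`; `F = Re f β`. [folklore] -/
theorem torusRemainder_tendsto_zero_of_freeEnergyWindowChannel
    (h : Summit.QuantumFields.YangMills.Theses.ComplexCouplingChannel.FreeEnergyWindowChannel)
    (G : Type) [Group G] [TopologicalSpace G] [IsTopologicalGroup G] [CompactSpace G] [MeasurableSpace G]
    [BorelSpace G] (hG : IsCompactSimpleLieGroup G) (r : LatticeRep G) :
    ∃ β₁ : ℝ, ∀ β : ℝ, β₁ ≤ β → ∃ F : ℝ,
      Tendsto (fun P : ℕ => Real.log (wilsonFinTorusPartition r.ρ β P P P P) + (P : ℝ) ^ 4 * F)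
        atTop (𝓝 0) := by
  haveI : SecondCountableTopology G :=
    (r.continuous.isClosedEmbedding r.injective).isEmbedding.secondCountableTopology
  set Z : ℕ → ℂ → ℂ := fun P z => wilsonFinTorusPartitionC r.ρ z P P P P with hZ
  have hZd : ∀ P : ℕ, Differentiable ℂ (Z P) := fun P =>
    differentiable_wilsonFinTorusPartitionC r.ρ r.continuous P P P P
  -- the proved anchor (torus clause)
  obtain ⟨ρ₀, hρ₀, c, hc, -, fA, -, C, hA⟩ :=
    Summit.QuantumFields.YangMills.Theorems.complexStrongCouplingAnchor_proof G hG r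
  have hA' : ∀ P : ℕ, 1 ≤ P → ∀ z : ℂ, ‖z‖ < ρ₀ → Z P z ≠ 0 ∧
      |Real.log ‖Z P z‖ + (P : ℝ) ^ 4 * (fA z).re| ≤ C * (P : ℝ) ^ 4 * Real.exp (-(c * P)) :=
    fun P hP z hz => hA P hP z hz
  -- the crux's window at `(β, ρ₀ / 2)`
  obtain ⟨β₁, hβ₁⟩ := h G hG r
  refine ⟨β₁, fun β hβ => ?_⟩
  obtain ⟨D, hDo, hDc, hβD, ⟨x, hxρ, hxD⟩, f, hf, M, P₀, hwin⟩ := hβ₁ β hβ (ρ₀ / 2) (half_pos hρ₀)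
  have hwin' : ∀ P : ℕ, P₀ ≤ P → ∀ z ∈ D, Z P z ≠ 0 ∧
      |Real.log ‖Z P z‖ + (P : ℝ) ^ 4 * (f z).re| ≤ M := fun P hP z hz => hwin P hP z hz
  set P₁ : ℕ := max P₀ 1 with hP₁
  -- a uniform constant for the anchor's remainder: `C P⁴ e^{-cP} ≤ C' · 24/(c/2)⁴ · e^{-(c/2)P}`
  set C' : ℝ := max C 0 with hC'
  have hc2 : 0 < c / 2 := half_pos hc
  set A : ℝ := C' * (24 / (c / 2) ^ 4) + 1 with hAdef
  have hA0 : 0 < A := by rw [hAdef]; positivity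
  set ε : ℕ → ℝ := fun P => A * Real.exp (-(c / 2 * P)) with hεdef
  have hε0 : ∀ P : ℕ, 0 < ε P := fun P => by rw [hεdef]; positivity
  have hεt : Tendsto ε atTop (𝓝 0) := by
    have h1 : Tendsto (fun P : ℕ => Real.exp (-(c / 2 * P))) atTop (𝓝 0) := by
      have := Real.tendsto_exp_neg_atTop_nhds_zero.comp
        ((tendsto_natCast_atTop_atTop (R := ℝ)).const_mul_atTop hc2)
      simpa [Function.comp_def] using this
    simpa [hεdef] using h1.const_mul A
  have hanchor_le : ∀ P : ℕ, C * (P : ℝ) ^ 4 * Real.exp (-(c * P)) ≤ ε P := by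
    intro P
    have hP0 : (0 : ℝ) ≤ P := Nat.cast_nonneg P
    have h24 := Summit.QuantumFields.YangMills.Theorems.ComplexCouplingChannel.pow_four_mul_exp_neg_le hc2 hP0
    have hsplit : Real.exp (-(c * P)) = Real.exp (-(c / 2 * P)) * Real.exp (-(c / 2 * P)) := by
      rw [← Real.exp_add]; congr 1; ring
    have hX : 0 ≤ (P : ℝ) ^ 4 * Real.exp (-(c * P)) := by positivity
    calc C * (P : ℝ) ^ 4 * Real.exp (-(c * P)) = C * ((P : ℝ) ^ 4 * Real.exp (-(c * P))) := by ring
      _ ≤ C' * ((P : ℝ) ^ 4 * Real.exp (-(c * P))) := mul_le_mul_of_nonneg_right (le_max_left _ _) hX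
      _ = C' * ((P : ℝ) ^ 4 * Real.exp (-(c / 2 * P))) * Real.exp (-(c / 2 * P)) := by rw [hsplit]; ring
      _ ≤ C' * (24 / (c / 2) ^ 4) * Real.exp (-(c / 2 * P)) :=
          mul_le_mul_of_nonneg_right (mul_le_mul_of_nonneg_left h24 (le_max_right _ _)) (Real.exp_pos _).le
      _ ≤ A * Real.exp (-(c / 2 * P)) := by
          gcongr; rw [hAdef]; linarith
      _ = ε P := by rw [hεdef]
  -- Step 1: on the overlap `D ∩ {‖w‖ < ρ₀}` the two windows pin `Re f = Re f_A`
  have hre : ∀ w ∈ D, ‖w‖ < ρ₀ → (f w).re = (fA w).re := by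
    intro w hwD hw
    have key : ∀ s : ℝ, (s = (f w).re - (fA w).re ∨ s = (fA w).re - (f w).re) → s ≤ 0 := by
      intro s hs
      refine nonpos_of_forall_pow_four_mul_le (P₀ := P₁) (K := M + A) fun P hP => ?_
      have hP₀ : P₀ ≤ P := (le_max_left _ _).trans hP
      have hP1 : 1 ≤ P := (le_max_right _ _).trans hP
      have h1 := (hwin' P hP₀ w hwD).2
      have h2 := ((hA' P hP1 w hw).2).trans (hanchor_le P)
      have hεA : ε P ≤ A := by
        rw [hεdef]
        have : Real.exp (-(c / 2 * P)) ≤ 1 := by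
          rw [Real.exp_le_one_iff]; nlinarith [hc2, (Nat.cast_nonneg P : (0 : ℝ) ≤ P)]
        nlinarith [hA0]
      rw [abs_le] at h1 h2
      rcases hs with hs | hs <;> rw [hs] <;> nlinarith [h1.1, h1.2, h2.1, h2.2, hεA]
    have h1 := key _ (Or.inl rfl)
    have h2 := key _ (Or.inr rfl)
    linarith
  -- Step 2: pinning of the crux's remainder on `D ∩ ball x (ρ₀/2) ⊆ {‖w‖ < ρ₀}`
  have hxD' : ((x : ℂ)) ∈ D := hxD
  have hpin : ∀ P : ℕ, P₁ ≤ P → ∀ w ∈ D, dist w (x : ℂ) < ρ₀ / 2 →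
      |Real.log ‖Z P w‖ + (P : ℝ) ^ 4 * (f w).re| ≤ ε P := by
    intro P hP w hwD hwx
    have hw : ‖w‖ < ρ₀ := by
      have hxn : ‖(x : ℂ)‖ < ρ₀ / 2 := by rw [norm_real, Real.norm_eq_abs]; exact hxρ
      calc ‖w‖ = ‖(w - x) + x‖ := by ring_nf
        _ ≤ ‖w - (x : ℂ)‖ + ‖(x : ℂ)‖ := norm_add_le _ _
        _ < ρ₀ / 2 + ρ₀ / 2 := by rw [← dist_eq_norm]; exact add_lt_add hwx hxn
        _ = ρ₀ := by ring
    rw [hre w hwD hw]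
    exact ((hA' P ((le_max_right _ _).trans hP) w hw).2).trans (hanchor_le P)
  -- Step 3: the engine, at the point `β`
  have hwin₁ : ∀ P : ℕ, P₁ ≤ P → ∀ z ∈ D, Z P z ≠ 0 ∧
      |Real.log ‖Z P z‖ + (P : ℝ) ^ 4 * (f z).re| ≤ M :=
    fun P hP z hz => hwin' P ((le_max_left _ _).trans hP) z hz
  have hlim := remainder_tendsto_zero_of_window_of_pinning Z D hDo hDc.isPreconnected hZd (x : ℂ) hxD'
    (ρ₀ / 2) (half_pos hρ₀) f hf M P₁ hwin₁ ε hε0 hεt hpin (β : ℂ) hβD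
  -- Step 4: at real `β` the complex partition function is the (positive) real one
  refine ⟨(f β).re, ?_⟩
  have hnorm : ∀ P : ℕ, ‖Z P (β : ℂ)‖ = wilsonFinTorusPartition r.ρ β P P P P := fun P => by
    simp only [hZ, wilsonFinTorusPartitionC_ofReal, Complex.norm_real, Real.norm_eq_abs]
    exact abs_of_pos (wilsonFinTorusPartition_pos r.continuous β P P P P)
  simpa only [hnorm] using hlim

/-- **Doubling form** (no bulk constant needed): under `FreeEnergyWindowChannel`, for every admissible `(G, r)` and
every `β ≥ β₁`, `log Z(β; (2P)⁴) − 16 · log Z(β; P⁴) → 0` as `P → ∞` (since `(2P)⁴ F = 16 P⁴ F`). [folklore] -/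
theorem doublingRemainder_tendsto_zero_of_freeEnergyWindowChannel
    (h : Summit.QuantumFields.YangMills.Theses.ComplexCouplingChannel.FreeEnergyWindowChannel)
    (G : Type) [Group G] [TopologicalSpace G] [IsTopologicalGroup G] [CompactSpace G] [MeasurableSpace G]
    [BorelSpace G] (hG : IsCompactSimpleLieGroup G) (r : LatticeRep G) :
    ∃ β₁ : ℝ, ∀ β : ℝ, β₁ ≤ β →
      Tendsto (fun P : ℕ => Real.log (wilsonFinTorusPartition r.ρ β (2 * P) (2 * P) (2 * P) (2 * P)) -
        16 * Real.log (wilsonFinTorusPartition r.ρ β P P P P)) atTop (𝓝 0) := by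
  obtain ⟨β₁, hβ₁⟩ := torusRemainder_tendsto_zero_of_freeEnergyWindowChannel h G hG r
  refine ⟨β₁, fun β hβ => ?_⟩
  obtain ⟨F, hF⟩ := hβ₁ β hβ
  set a : ℕ → ℝ := fun P => Real.log (wilsonFinTorusPartition r.ρ β P P P P) + (P : ℝ) ^ 4 * F with ha
  have h2P : Tendsto (fun P : ℕ => 2 * P) atTop atTop := tendsto_id.const_mul_atTop' two_pos
  have h2 : Tendsto (fun P : ℕ => a (2 * P)) atTop (𝓝 0) := hF.comp h2P
  have h3 : Tendsto (fun P : ℕ => a (2 * P) - 16 * a P) atTop (𝓝 0) := by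
    simpa using h2.sub (hF.const_mul 16)
  refine h3.congr' (Eventually.of_forall fun P => ?_)
  simp only [ha, Nat.cast_mul, Nat.cast_ofNat]
  ring

/-! ## §3 The negative lemmas -/

/-- **The crux is false at any admissible `(G, r)` whose torus remainder does not vanish**: if at arbitrarily large real
couplings `β` the symmetric-torus remainder `log Z(β; P⁴) + P⁴ F` fails to tend to `0` for EVERY real constant `F`, then
`FreeEnergyWindowChannel` fails (contrapositive of `torusRemainder_tendsto_zero_of_freeEnergyWindowChannel`). [folklore] -/
theorem not_freeEnergyWindowChannel_of_torusRemainder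
    (G : Type) [Group G] [TopologicalSpace G] [IsTopologicalGroup G] [CompactSpace G] [MeasurableSpace G]
    [BorelSpace G] (hG : IsCompactSimpleLieGroup G) (r : LatticeRep G)
    (hκ : ∀ b : ℝ, ∃ β : ℝ, b ≤ β ∧ ∀ F : ℝ,
      ¬ Tendsto (fun P : ℕ => Real.log (wilsonFinTorusPartition r.ρ β P P P P) + (P : ℝ) ^ 4 * F)
        atTop (𝓝 0)) :
    ¬ Summit.QuantumFields.YangMills.Theses.ComplexCouplingChannel.FreeEnergyWindowChannel := by
  intro h
  obtain ⟨β₁, hβ₁⟩ := torusRemainder_tendsto_zero_of_freeEnergyWindowChannel h G hG r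
  obtain ⟨β, hb, hno⟩ := hκ β₁
  obtain ⟨F, hF⟩ := hβ₁ β hb
  exact hno F hF

/-- **The crux is false at any admissible `(G, r)` whose doubling remainder does not vanish**: if at arbitrarily large
real `β` the `F`-free combination `log Z(β; (2P)⁴) − 16 log Z(β; P⁴)` fails to tend to `0`, then `FreeEnergyWindowChannel`
fails. [folklore] -/
theorem not_freeEnergyWindowChannel_of_doublingRemainder
    (G : Type) [Group G] [TopologicalSpace G] [IsTopologicalGroup G] [CompactSpace G] [MeasurableSpace G]
    [BorelSpace G] (hG : IsCompactSimpleLieGroup G) (r : LatticeRep G)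
    (hκ : ∀ b : ℝ, ∃ β : ℝ, b ≤ β ∧
      ¬ Tendsto (fun P : ℕ => Real.log (wilsonFinTorusPartition r.ρ β (2 * P) (2 * P) (2 * P) (2 * P)) -
        16 * Real.log (wilsonFinTorusPartition r.ρ β P P P P)) atTop (𝓝 0)) :
    ¬ Summit.QuantumFields.YangMills.Theses.ComplexCouplingChannel.FreeEnergyWindowChannel := by
  intro h
  obtain ⟨β₁, hβ₁⟩ := doublingRemainder_tendsto_zero_of_freeEnergyWindowChannel h G hG r
  obtain ⟨β, hb, hno⟩ := hκ β₁
  exact hno (hβ₁ β hb)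


/-- **Registered stub `stub_torusRemainderRigidity` of line `Sketch`** (layer 3, lead c2; the name under which the lead's
skeleton consumes `torusRemainder_tendsto_zero_of_freeEnergyWindowChannel`): the crux forces the symmetric-torus remainder
`log Z(β; P⁴) + P⁴ F` to tend to `0` for some real `F`, at every large real `β`, for every admissible `(G, r)`. [folklore] -/
theorem stub_torusRemainderRigidity :
    Summit.QuantumFields.YangMills.Theses.ComplexCouplingChannel.FreeEnergyWindowChannel →
    ∀ (G : Type) [Group G] [TopologicalSpace G] [IsTopologicalGroup G] [CompactSpace G] [MeasurableSpace G] [BorelSpace G], Literature.MathematicalPhysics.QuantumFieldTheory.IsCompactSimpleLieGroup G → ∀ r : Literature.MathematicalPhysics.QuantumFieldTheory.LatticeRep G,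
      ∃ β₁ : ℝ, ∀ β : ℝ, β₁ ≤ β → ∃ F : ℝ,
        Filter.Tendsto (fun P : ℕ =>
          Real.log (Literature.MathematicalPhysics.QuantumFieldTheory.wilsonFinTorusPartition r.ρ β P P P P) +
            (P : ℝ) ^ 4 * F) Filter.atTop (nhds 0) :=
  fun h G _ _ _ _ _ _ hG r => torusRemainder_tendsto_zero_of_freeEnergyWindowChannel h G hG r

end Summit.QuantumFields.YangMills.Theorems.FreeEnergyWindowChannel.Negative

end
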